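import Summits.AtomisticToContinuum.FouriersLaw.Theorems.LocalOhmBVBVProfileReductions

/-!
# `TransferKernelPositivity.TPGlue` (item stmt-AtomisticToContinuum-12013): `Passivity → MonotoneProfile → BVProfile`

The glue item of route `TransferKernelPositivity` is literally the conditional closure of the shared crux `BVProfile`
(item stmt-AtomisticToContinuum-12012) landed for line `registered` in
`Theorems/LocalOhmBVBVProfileReductions.lean` (`transferKernelPositivity_bvProfile_of_passivity_of_monotoneProfile`:
seam `Theorems/LocalOhmBVBVProfileSeam.lean` with `B = 1/2` from `Passivity` and `K = 0` from `MonotoneProfile`, so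
`C = 2ℓ + 1`). No definitions. [folklore]
-/

namespace Summit.AtomisticToContinuum.FouriersLaw.Theorems

/-- **`TPGlue` holds**: `Passivity → MonotoneProfile → BVProfile` for route `TransferKernelPositivity`, by the landed
conditional closure of the shared crux `BVProfile` (bulk decrements telescope, `≤ 2ℓ` boundary bonds cost `≤ 1` each:
`Σ_bonds |Δθ| ≤ 2ℓ + 1`). [folklore] -/
theorem tpGlue_proof : _root_.Summit.AtomisticToContinuum.FouriersLaw.Theses.TransferKernelPositivity.TPGlue :=
  fun hP hM => transferKernelPositivity_bvProfile_of_passivity_of_monotoneProfile hP hM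

end Summit.AtomisticToContinuum.FouriersLaw.Theorems
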